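import Mathlib
import Summits.AtomisticToContinuum.Crystallization.Theorems.GappedShellCensusFiveFoldRationingRStubFfrC5KillsAux3

/-!
# Crux `GappedShellCensus.FiveFoldRationingR` (stmt-AtomisticToContinuum-18071), line `Sketch` —
# stub `stub_ffrC5Kills`: the angle-budget kills on abstract fan data

Abstract fan data of a gapped twelve-shell: a Boolean bond relation on `Fin 12` with degrees in
`[4, 5]`, fan triangles (twenty 3-sets, two per side, bonds are sides, bonded 3-cliques are
triangles, flag-connected links), corner angles summing to `2π` at every label with the
dictionary's bounds (`T ∈ [arccos (81/200), arccos (1/4)]`, `H ≤ arccos (807/2000)`,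
`Q ∈ [arccos (1/25), 2·arccos (807/2000)]`, `H`-pair `≥ arccos (1/25)`), the face condition (every
fan triangle has a vertex bonded to the other two) and the open-star exclusion.  Conclusion
(`stub_ffrC5Kills`): a `5`-valent label has only bond triangles in its star, a `4`-valent label at
most two.

Proof (`ffrK_main`): at a label `v` split the fan triangles into bond triangles `F`, quad corners
`Q` and `H`-triangles (paired around the non-partners `N` of the link); double counting partner
incidences gives `|F| + |Q| + |N| = deg v`, and the node equation is squeezed between
`|F|·arccos(81/200) + (|Q|+|N|)·arccos(1/25)` and `|F|·arccos(1/4) + 2(|Q|+|N|)·arccos(807/2000)`.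
With `3·arccos(81/200) + 2·arccos(1/25) > 2π` a five-valent label has `|F| ≥ 4`, and `|F| = 4` is
the open star (parts 2, 3); with `3·arccos(1/4) + 2·arccos(807/2000) < 2π` and `4·arccos(1/4) < 2π`
a four-valent label has `|F| ≤ 2`.
-/

noncomputable section

namespace Summit.AtomisticToContinuum.Crystallization.Theorems

open Real

/-! ### The kills at one label -/

/-- **The kills at a label `v`.**  Split the fan triangles at `v` into bond triangles (`F`), quad
corners (`Q`: both other vertices partners of `v`, not bonded to each other) and `H`-triangles
(through a non-partner `x` of the link; they come in pairs `{v,x,a}, {v,x,z}` around each such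
`x`, the set `N` of these `x`).  Double counting partner incidences gives `|F| + |Q| + |N| = deg v`,
and the node equation `Σ ang = 2π` is bounded below by `|F|·arccos(81/200) + (|Q|+|N|)·arccos(1/25)`
and above by `|F|·arccos(1/4) + 2(|Q|+|N|)·arccos(807/2000)`.  For `deg v = 5` this leaves
`|F| ≥ 4`, and `|F| = 4` is the open star (`stub_ffrC5KillsFourQ`, `ffrK_fourH`); for `deg v = 4`,
`|F| ≥ 3` violates the
upper budget. [folklore] -/
theorem ffrK_main (bond : Fin 12 → Fin 12 → Bool) (tri : Finset (Finset (Fin 12)))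
    (ang : Finset (Fin 12) → Fin 12 → ℝ)
    (bond_symm : ∀ v w, bond v w = bond w v) (bond_irrefl : ∀ v, bond v v = false)
    (bond_deg : ∀ v, 4 ≤ (Finset.univ.filter fun w => bond v w = true).card ∧
      (Finset.univ.filter fun w => bond v w = true).card ≤ 5)
    (tri_card : ∀ S ∈ tri, S.card = 3)
    (two_per_side : ∀ S ∈ tri, ∀ s ⊆ S, s.card = 2 → (tri.filter fun S' => s ⊆ S').card = 2)
    (bond_side : ∀ v w, bond v w = true → (tri.filter fun S' => ({v, w} : Finset (Fin 12)) ⊆ S').card = 2)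
    (bond_tri : ∀ a b c, a ≠ b → b ≠ c → a ≠ c → bond a b = true → bond b c = true → bond a c = true →
      ({a, b, c} : Finset (Fin 12)) ∈ tri)
    (link : ∀ v, ∀ A ⊆ tri.filter (fun S => v ∈ S), A.Nonempty →
      (∀ S ∈ A, ∀ S' ∈ tri, v ∈ S' → (S ∩ S').card = 2 → S' ∈ A) → A = tri.filter fun S => v ∈ S)
    (ang_zero : ∀ S v, v ∉ S → ang S v = 0)
    (sum_ang : ∀ v, ∑ S ∈ tri, ang S v = 2 * Real.pi)
    (tCorner : ∀ S ∈ tri, (∀ v ∈ S, ∀ w ∈ S, v ≠ w → bond v w = true) → ∀ v ∈ S, ang S v ≤ Real.arccos (1 / 4))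
    (tCornerMin : ∀ S ∈ tri, (∀ v ∈ S, ∀ w ∈ S, v ≠ w → bond v w = true) →
      ∀ v ∈ S, Real.arccos (81 / 200) ≤ ang S v)
    (hCorner : ∀ v a x, ({v, a, x} : Finset (Fin 12)) ∈ tri → bond v a = true → bond a x = true →
      bond v x = false → v ≠ x → ang {v, a, x} v ≤ Real.arccos (807 / 2000))
    (qCorner : ∀ v d a x, ({v, d, a} : Finset (Fin 12)) ∈ tri → bond v d = true → bond v a = true →
      bond d a = false → d ≠ a → bond d x = true → bond x a = true → bond v x = false → x ≠ v →
      ang {v, d, a} v ≤ 2 * Real.arccos (807 / 2000))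
    (qCornerMin : ∀ v d a, ({v, d, a} : Finset (Fin 12)) ∈ tri → bond v d = true → bond v a = true →
      bond d a = false → d ≠ a → Real.arccos (1 / 25) ≤ ang {v, d, a} v)
    (hPairMin : ∀ v a x z, ({v, a, x} : Finset (Fin 12)) ∈ tri → ({v, x, z} : Finset (Fin 12)) ∈ tri →
      bond v a = true → bond v z = true → bond a z = false → a ≠ z →
      Real.arccos (1 / 25) ≤ ang {v, a, x} v + ang {v, x, z} v)
    (two_bond_sides : ∀ S ∈ tri, ∃ a ∈ S, ∀ b ∈ S, b ≠ a → bond a b = true)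
    (noOpenStar : ∀ v a₁ a₂ a₃ a₄ a₅ x : Fin 12, Function.Injective ![v, a₁, a₂, a₃, a₄, a₅, x] →
      bond v a₁ = true → bond v a₂ = true → bond v a₃ = true → bond v a₄ = true → bond v a₅ = true →
      bond a₁ a₂ = true → bond a₂ a₃ = true → bond a₃ a₄ = true → bond a₄ a₅ = true → bond a₅ a₁ = false →
      bond x a₅ = true → bond x a₁ = true → bond v x = false → False) (v : Fin 12) :
    ((Finset.univ.filter fun w => bond v w = true).card = 5 →
      ∀ S ∈ tri, v ∈ S → ∀ a ∈ S, ∀ b ∈ S, a ≠ b → bond a b = true) ∧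
    ((Finset.univ.filter fun w => bond v w = true).card = 4 →
      ((tri.filter fun S => v ∈ S).filter fun S => ∀ a ∈ S, ∀ b ∈ S, a ≠ b → bond a b = true).card ≤ 2) := by
  have ne_of_bond : ∀ {p q : Fin 12}, bond p q = true → p ≠ q := fun h e => by
    rw [e, bond_irrefl] at h
    exact Bool.false_ne_true h
  have hP4 : 4 ≤ (Finset.univ.filter fun w => bond v w = true).card := (bond_deg v).1
  -- the players
  obtain ⟨P, hP⟩ : ∃ P : Finset (Fin 12), P = Finset.univ.filter fun w => bond v w = true := ⟨_, rfl⟩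
  obtain ⟨Tv, hTv⟩ : ∃ Tv : Finset (Finset (Fin 12)), Tv = tri.filter fun S => v ∈ S := ⟨_, rfl⟩
  obtain ⟨F, hF⟩ : ∃ F : Finset (Finset (Fin 12)),
      F = Tv.filter fun S => ∀ a ∈ S, ∀ b ∈ S, a ≠ b → bond a b = true := ⟨_, rfl⟩
  obtain ⟨Tv2, hTv2⟩ : ∃ Tv2 : Finset (Finset (Fin 12)),
      Tv2 = Tv.filter fun S => ∀ w ∈ S, w ≠ v → bond v w = true := ⟨_, rfl⟩
  obtain ⟨H, hH⟩ : ∃ H : Finset (Finset (Fin 12)),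
      H = Tv.filter fun S => ¬ ∀ w ∈ S, w ≠ v → bond v w = true := ⟨_, rfl⟩
  obtain ⟨Q, hQ⟩ : ∃ Q : Finset (Finset (Fin 12)),
      Q = Tv2.filter fun S => ¬ ∀ a ∈ S, ∀ b ∈ S, a ≠ b → bond a b = true := ⟨_, rfl⟩
  obtain ⟨N, hN⟩ : ∃ N : Finset (Fin 12),
      N = Finset.univ.filter fun x => x ≠ v ∧ bond v x = false ∧ ∃ S ∈ tri, v ∈ S ∧ x ∈ S := ⟨_, rfl⟩
  rw [← hP] at hP4 ⊢
  rw [← hTv, ← hF]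
  have memP : ∀ w, w ∈ P ↔ bond v w = true := fun w => by rw [hP]; simp
  have memTv : ∀ S, S ∈ Tv ↔ S ∈ tri ∧ v ∈ S := fun S => by rw [hTv, Finset.mem_filter]
  have memF : ∀ S, S ∈ F ↔ S ∈ Tv ∧ ∀ a ∈ S, ∀ b ∈ S, a ≠ b → bond a b = true := fun S => by
    rw [hF, Finset.mem_filter]
  have memTv2 : ∀ S, S ∈ Tv2 ↔ S ∈ Tv ∧ ∀ w ∈ S, w ≠ v → bond v w = true := fun S => by
    rw [hTv2, Finset.mem_filter]
  have memH : ∀ S, S ∈ H ↔ S ∈ Tv ∧ ∃ x ∈ S, x ≠ v ∧ bond v x = false := fun S => by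
    rw [hH, Finset.mem_filter]
    refine and_congr_right fun _ => ⟨fun h => ?_, fun ⟨x, hx, hxv, hb⟩ h => ?_⟩
    · push Not at h
      obtain ⟨x, hx, hxv, hb⟩ := h
      exact ⟨x, hx, hxv, by simpa using hb⟩
    · rw [h x hx hxv] at hb
      exact Bool.false_ne_true hb.symm
  have memQ : ∀ S, S ∈ Q ↔ S ∈ Tv2 ∧ ¬ ∀ a ∈ S, ∀ b ∈ S, a ≠ b → bond a b = true := fun S => by
    rw [hQ, Finset.mem_filter]
  have memN : ∀ x, x ∈ N ↔ x ≠ v ∧ bond v x = false ∧ ∃ S ∈ tri, v ∈ S ∧ x ∈ S := fun x => by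
    rw [hN]; simp
  -- (1) the node equation at `v`
  have hsum : ∑ S ∈ Tv, ang S v = 2 * π := by
    rw [← sum_ang v, hTv, Finset.sum_filter]
    refine Finset.sum_congr rfl fun S _ => ?_
    split_ifs with h
    · rfl
    · exact (ang_zero S v h).symm
  -- (2) fibres: two triangles at `v` through each partner and through each `x ∈ N`
  have hfibP : ∀ p ∈ P, (Tv.filter fun S => p ∈ S).card = 2 := fun p hp => by
    rw [hTv]; exact ffrK_fib_two_bond bond tri bond_side ((memP p).1 hp)
  have hfibN : ∀ x ∈ N, (Tv.filter fun S => x ∈ S).card = 2 := fun x hx => by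
    obtain ⟨hxv, -, S, hS, hvS, hxS⟩ := (memN x).1 hx
    rw [hTv]; exact ffrK_fib_two tri two_per_side hS hvS hxS hxv.symm
  -- (3) the local picture of an `H`-triangle
  have hHpic : ∀ S ∈ H, ∃ x u, S = {v, x, u} ∧ x ≠ v ∧ u ≠ v ∧ u ≠ x ∧ bond v x = false ∧
      bond v u = true ∧ bond u x = true := by
    intro S hS
    obtain ⟨hST, x, hxS, hxv, hvx⟩ := (memH S).1 hS
    obtain ⟨hStri, hvS⟩ := (memTv S).1 hST
    obtain ⟨u, huv, hux, hSeq⟩ := ffrK_third (tri_card S hStri) hvS hxS hxv.symm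
    obtain ⟨hvu, hux'⟩ := ffrK_tbs bond tri bond_symm two_bond_sides (hSeq ▸ hStri) hxv huv hux hvx
    exact ⟨x, u, hSeq, hxv, huv, hux, hvx, hvu, hux'⟩
  -- (4) splitting `Tv = Tv2 ⊔ H`, `Tv2 = F ⊔ Q`
  have hF_eq : (Tv2.filter fun S => ∀ a ∈ S, ∀ b ∈ S, a ≠ b → bond a b = true) = F := by
    rw [hF, hTv2, Finset.filter_filter]
    refine Finset.filter_congr fun S hS => ⟨fun h => h.2, fun h => ⟨fun w hw hwv => ?_, h⟩⟩
    exact h v ((memTv S).1 hS).2 w hw hwv.symm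
  have hcardTv2 : F.card + Q.card = Tv2.card := by
    rw [← hF_eq, hQ]; exact Finset.card_filter_add_card_filter_not _
  have hsumTv : ∑ S ∈ Tv2, ang S v + ∑ S ∈ H, ang S v = ∑ S ∈ Tv, ang S v := by
    rw [hTv2, hH]; exact Finset.sum_filter_add_sum_filter_not _ _ _
  have hsumTv2 : ∑ S ∈ F, ang S v + ∑ S ∈ Q, ang S v = ∑ S ∈ Tv2, ang S v := by
    rw [← hF_eq, hQ]; exact Finset.sum_filter_add_sum_filter_not _ _ _
  -- (5) `H` is the disjoint union over `x ∈ N` of the two triangles through `v, x`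
  have hH_eq : H = N.biUnion fun x => Tv.filter fun S => x ∈ S := by
    ext S
    rw [memH, Finset.mem_biUnion]
    constructor
    · rintro ⟨hS, x, hxS, hxv, hb⟩
      refine ⟨x, (memN x).2 ⟨hxv, hb, S, ((memTv S).1 hS).1, ((memTv S).1 hS).2, hxS⟩, ?_⟩
      exact Finset.mem_filter.2 ⟨hS, hxS⟩
    · rintro ⟨x, hx, hS⟩
      rw [Finset.mem_filter] at hS
      obtain ⟨hxv, hb, -⟩ := (memN x).1 hx
      exact ⟨hS.1, x, hS.2, hxv, hb⟩
  have hdisj : (N : Set (Fin 12)).PairwiseDisjoint fun x => Tv.filter fun S => x ∈ S := by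
    intro x hx x' hx' hxx'
    simp only [Function.onFun, Finset.disjoint_left]
    intro S hS hS'
    rw [Finset.mem_filter] at hS hS'
    obtain ⟨hxv, hvx, -⟩ := (memN x).1 (Finset.mem_coe.1 hx)
    obtain ⟨hx'v, hvx', -⟩ := (memN x').1 (Finset.mem_coe.1 hx')
    obtain ⟨hStri, hvS⟩ := (memTv S).1 hS.1
    obtain ⟨u, huv, hux, hSeq⟩ := ffrK_third (tri_card S hStri) hvS hS.2 hxv.symm
    have hx'u : x' = u := by
      have h := hS'.2
      rw [hSeq] at h
      simp only [Finset.mem_insert, Finset.mem_singleton] at h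
      rcases h with h | h | h
      · exact absurd h hx'v
      · exact absurd h (Ne.symm hxx')
      · exact h
    have h := (ffrK_tbs bond tri bond_symm two_bond_sides (hSeq ▸ hStri) hxv huv hux hvx).1
    rw [← hx'u, hvx'] at h
    exact Bool.false_ne_true h
  have hcardH : H.card = N.card * 2 := by
    rw [hH_eq, Finset.card_biUnion hdisj, Finset.sum_const_nat fun x hx => hfibN x hx]
  have hsumH : ∑ S ∈ H, ang S v = ∑ x ∈ N, ∑ S ∈ Tv.filter (fun S => x ∈ S), ang S v := by
    rw [hH_eq, Finset.sum_biUnion hdisj]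
  -- (6) double counting partner incidences: `|F| + |Q| + |N| = |P|`
  have hinter2 : ∀ S ∈ Tv2, (P ∩ S).card = 2 := by
    intro S hS
    obtain ⟨hST, hC⟩ := (memTv2 S).1 hS
    obtain ⟨hStri, hvS⟩ := (memTv S).1 hST
    have : P ∩ S = S.erase v := by
      ext w
      rw [Finset.mem_inter, Finset.mem_erase, memP]
      constructor
      · rintro ⟨hb, hw⟩
        exact ⟨(ne_of_bond hb).symm, hw⟩
      · rintro ⟨hwv, hw⟩
        exact ⟨hC w hw hwv, hw⟩
    rw [this, Finset.card_erase_of_mem hvS, tri_card S hStri]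
  have hinter1 : ∀ S ∈ H, (P ∩ S).card = 1 := by
    intro S hS
    obtain ⟨x, u, hSeq, hxv, huv, hux, hvx, hvu, hux'⟩ := hHpic S hS
    have : P ∩ S = {u} := by
      ext w
      rw [Finset.mem_inter, memP, hSeq, Finset.mem_singleton]
      simp only [Finset.mem_insert, Finset.mem_singleton]
      constructor
      · rintro ⟨hb, h | h | h⟩
        · exact absurd h (ne_of_bond hb).symm
        · rw [h, hvx] at hb
          exact absurd hb Bool.false_ne_true
        · exact h
      · rintro rfl
        exact ⟨hvu, Or.inr (Or.inr rfl)⟩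
    rw [this, Finset.card_singleton]
  have hdc : ∑ S ∈ Tv, (P ∩ S).card = P.card * 2 := Finset.sum_card_inter fun p hp => hfibP p hp
  have hcount : F.card + Q.card + N.card = P.card := by
    have h1 : ∑ S ∈ Tv2, (P ∩ S).card + ∑ S ∈ H, (P ∩ S).card = ∑ S ∈ Tv, (P ∩ S).card := by
      rw [hTv2, hH]; exact Finset.sum_filter_add_sum_filter_not _ _ _
    rw [Finset.sum_const_nat hinter2, Finset.sum_const_nat hinter1, hdc, hcardH] at h1
    omega
  -- (7) corner bounds, sector by sector
  have ptF : ∀ S ∈ F, arccos (81 / 200) ≤ ang S v ∧ ang S v ≤ arccos (1 / 4) := fun S hS => by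
    obtain ⟨hST, hFB⟩ := (memF S).1 hS
    obtain ⟨hStri, hvS⟩ := (memTv S).1 hST
    exact ⟨tCornerMin S hStri hFB v hvS, tCorner S hStri hFB v hvS⟩
  have ptQ : ∀ S ∈ Q, arccos (1 / 25) ≤ ang S v ∧ ang S v ≤ 2 * arccos (807 / 2000) := by
    intro S hS
    obtain ⟨hS2, hnF⟩ := (memQ S).1 hS
    obtain ⟨hST, hC⟩ := (memTv2 S).1 hS2
    obtain ⟨hStri, hvS⟩ := (memTv S).1 hST
    obtain ⟨d, a, hSeq, hdv, hav, had, hvd, hva, hda⟩ :=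
      ffrK_qtri bond tri bond_symm tri_card hStri hvS hC hnF
    rw [hSeq] at hStri ⊢
    obtain ⟨x, hdx, hxa, hvx, hxv⟩ := ffrK_qclose bond tri bond_symm bond_irrefl tri_card
      two_per_side bond_side bond_tri link two_bond_sides (hP ▸ hP4) hStri hdv hav had hvd hva hda
    exact ⟨qCornerMin v d a hStri hvd hva hda had.symm,
      qCorner v d a x hStri hvd hva hda had.symm hdx hxa hvx hxv⟩
  have ptN : ∀ x ∈ N, arccos (1 / 25) ≤ ∑ S ∈ Tv.filter (fun S => x ∈ S), ang S v := by
    intro x hx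
    obtain ⟨hxv, hvx, S₀, hS₀, hvS₀, hxS₀⟩ := (memN x).1 hx
    obtain ⟨a, z, heq, hne, h1, h2, -, -, -, -, haz, hva, -, hvz, -, hazb⟩ :=
      ffrK_hpair bond tri bond_symm bond_irrefl tri_card two_per_side bond_side bond_tri link
        two_bond_sides (hP ▸ hP4) hxv hvx hS₀ hvS₀ hxS₀
    rw [hTv, heq, Finset.sum_pair hne]
    have h1' : ({v, a, x} : Finset (Fin 12)) ∈ tri := by rw [ffrK_swap]; exact h1
    have := hPairMin v a x z h1' h2 hva hvz hazb haz
    rwa [ffrK_swap v a x] at this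
  have ptH : ∀ S ∈ H, ang S v ≤ arccos (807 / 2000) := fun S hS => by
    obtain ⟨x, u, hSeq, hxv, -, -, hvx, hvu, hux'⟩ := hHpic S hS
    have hStri : S ∈ tri := ((memTv S).1 ((memH S).1 hS).1).1
    rw [hSeq, ffrK_swap] at hStri ⊢
    exact hCorner v u x hStri hvu hux' hvx hxv.symm
  have hF_lo := Finset.card_nsmul_le_sum F (fun S => ang S v) _ fun S hS => (ptF S hS).1
  have hF_hi := Finset.sum_le_card_nsmul F (fun S => ang S v) _ fun S hS => (ptF S hS).2
  have hQ_lo := Finset.card_nsmul_le_sum Q (fun S => ang S v) _ fun S hS => (ptQ S hS).1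
  have hQ_hi := Finset.sum_le_card_nsmul Q (fun S => ang S v) _ fun S hS => (ptQ S hS).2
  have hN_lo := Finset.card_nsmul_le_sum N (fun x => ∑ S ∈ Tv.filter (fun S => x ∈ S), ang S v) _ ptN
  have hH_hi := Finset.sum_le_card_nsmul H (fun S => ang S v) _ ptH
  rw [nsmul_eq_mul] at hF_lo hF_hi hQ_lo hQ_hi hN_lo hH_hi
  -- (8) the two budgets in terms of `f = |F|`, `q = |Q|`, `n = |N|`
  have hlow : (F.card : ℝ) * arccos (81 / 200) + ((Q.card : ℝ) + N.card) * arccos (1 / 25) ≤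
      2 * π := by
    rw [← hsum, ← hsumTv, ← hsumTv2, hsumH]
    linarith
  have hupp : 2 * π ≤ (F.card : ℝ) * arccos (1 / 4) +
      (2 * ((Q.card : ℝ) + N.card)) * arccos (807 / 2000) := by
    rw [← hsum, ← hsumTv, ← hsumTv2]
    have : (H.card : ℝ) = N.card * 2 := by exact_mod_cast hcardH
    rw [this] at hH_hi
    linarith
  -- (9) a triangle at `v` outside `Q` and `H` is a bond triangle
  have hFB : ∀ S ∈ tri, v ∈ S → S ∉ Q → S ∉ H → ∀ p ∈ S, ∀ q ∈ S, p ≠ q → bond p q = true := by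
    intro S hS hvS hSQ hSH
    have hST : S ∈ Tv := (memTv S).2 ⟨hS, hvS⟩
    by_contra hnF
    by_cases hC : ∀ w ∈ S, w ≠ v → bond v w = true
    · exact hSQ ((memQ S).2 ⟨(memTv2 S).2 ⟨hST, hC⟩, hnF⟩)
    · exact hSH (by rw [hH]; exact Finset.mem_filter.2 ⟨hST, hC⟩)
  constructor
  · -- **K5**: five partners ⇒ every fan triangle at `v` is a bond triangle
    intro hP5 S hS hvS
    have hcount5 : F.card + Q.card + N.card = 5 := by rw [hcount, hP5]
    -- `|F| ≥ 4` from the lower budget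
    have hf4 : 4 ≤ F.card := by
      by_contra hlt
      have hqn : (2 : ℝ) ≤ (Q.card : ℝ) + N.card := by
        have : 2 ≤ Q.card + N.card := by omega
        exact_mod_cast this
      have hsum' : (F.card : ℝ) + Q.card + N.card = 5 := by exact_mod_cast hcount5
      have key : ((Q.card : ℝ) + N.card - 2) * arccos (81 / 200) ≤
          ((Q.card : ℝ) + N.card - 2) * arccos (1 / 25) :=
        mul_le_mul_of_nonneg_left ffrK_num_mono (by linarith)
      nlinarith [ffrK_num_lower, arccos_nonneg (81 / 200 : ℝ)]
    rcases Nat.lt_or_ge 4 F.card with h5 | h4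
    · -- `|F| = 5`: no exceptional triangle at all
      have hQ0 : Q = ∅ := by rw [← Finset.card_eq_zero]; omega
      have hH0 : H = ∅ := by rw [← Finset.card_eq_zero, hcardH]; omega
      exact hFB S hS hvS (by rw [hQ0]; exact Finset.notMem_empty S)
        (by rw [hH0]; exact Finset.notMem_empty S)
    · -- `|F| = 4`: exactly one exceptional sector, an open star
      exfalso
      rcases Nat.eq_zero_or_pos N.card with hN0 | hNpos
      · -- `Q = {Sq}`: a `4T+Q` star
        have hQ1 : Q.card = 1 := by omega
        obtain ⟨Sq, hQeq⟩ := Finset.card_eq_one.1 hQ1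
        have hSq : Sq ∈ Q := by rw [hQeq]; exact Finset.mem_singleton_self _
        obtain ⟨hSq2, hnF⟩ := (memQ Sq).1 hSq
        obtain ⟨hSqT, hC⟩ := (memTv2 Sq).1 hSq2
        obtain ⟨hSqtri, hvSq⟩ := (memTv Sq).1 hSqT
        have hH0 : H = ∅ := by rw [← Finset.card_eq_zero, hcardH, hN0]
        refine stub_ffrC5KillsFourQ bond tri bond_symm bond_irrefl tri_card two_per_side bond_side
          bond_tri link two_bond_sides noOpenStar v Sq (hP ▸ hP5) hSqtri hvSq hC hnF
          fun S hS hvS hne => ?_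
        refine hFB S hS hvS (fun h => hne ?_) (by rw [hH0]; exact Finset.notMem_empty S)
        rw [hQeq] at h
        exact Finset.mem_singleton.1 h
      · -- `N = {x}`: a `4T+H-pair` star
        have hN1 : N.card = 1 := by omega
        have hQ0 : Q = ∅ := by rw [← Finset.card_eq_zero]; omega
        obtain ⟨x, hNeq⟩ := Finset.card_eq_one.1 hN1
        have hx : x ∈ N := by rw [hNeq]; exact Finset.mem_singleton_self _
        obtain ⟨hxv, hvx, S₀, hS₀, hvS₀, hxS₀⟩ := (memN x).1 hx
        refine ffrK_fourH bond tri bond_symm bond_irrefl tri_card two_per_side bond_side bond_tri link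
          two_bond_sides noOpenStar (hP ▸ hP5) hxv hvx hS₀ hvS₀ hxS₀ fun S hS hvS hxS => ?_
        refine hFB S hS hvS (by rw [hQ0]; exact Finset.notMem_empty S) fun hSH => hxS ?_
        rw [hH_eq, hNeq, Finset.singleton_biUnion, Finset.mem_filter] at hSH
        exact hSH.2
  · -- **K4**: four partners ⇒ at most two bond triangles at `v`
    intro hP4'
    have hcount4 : F.card + Q.card + N.card = 4 := by rw [hcount, hP4']
    by_contra hlt
    push Not at hlt
    have hupper := ffrK_num_upper
    have hfour := ffrK_num_four
    rcases Nat.lt_or_ge 3 F.card with h4 | h3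
    · have hf : F.card = 4 := by omega
      have hqn : Q.card + N.card = 0 := by omega
      have hf' : (F.card : ℝ) = 4 := by exact_mod_cast hf
      have hqn' : (Q.card : ℝ) + N.card = 0 := by exact_mod_cast hqn
      rw [hf', hqn'] at hupp
      linarith
    · have hf : F.card = 3 := by omega
      have hqn : Q.card + N.card = 1 := by omega
      have hf' : (F.card : ℝ) = 3 := by exact_mod_cast hf
      have hqn' : (Q.card : ℝ) + N.card = 1 := by exact_mod_cast hqn
      rw [hf', hqn'] at hupp
      linarith

/-! ### The registered stub -/

/-- **Sub-stub K (kills; PROVABLE NOW, hand).**  On abstract fan data with the dictionary's bounds, the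
face condition (C2) and the open-star exclusion (C1): a `5`-valent label has only bonded fan triangles
(`5T`), and a `4`-valent label has at most two bonded fan triangles (no `4T`, no `3T+Q`). [folklore] -/
theorem stub_ffrC5Kills (bond : Fin 12 → Fin 12 → Bool) (tri : Finset (Finset (Fin 12)))
    (ang : Finset (Fin 12) → Fin 12 → ℝ)
    (bond_symm : ∀ v w, bond v w = bond w v) (bond_irrefl : ∀ v, bond v v = false)
    (bond_deg : ∀ v, 4 ≤ (Finset.univ.filter fun w => bond v w = true).card ∧
      (Finset.univ.filter fun w => bond v w = true).card ≤ 5)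
    (tri_card : ∀ S ∈ tri, S.card = 3) (card_tri : tri.card = 20)
    (two_per_side : ∀ S ∈ tri, ∀ s ⊆ S, s.card = 2 → (tri.filter fun S' => s ⊆ S').card = 2)
    (bond_side : ∀ v w, bond v w = true → (tri.filter fun S' => ({v, w} : Finset (Fin 12)) ⊆ S').card = 2)
    (bond_tri : ∀ a b c, a ≠ b → b ≠ c → a ≠ c → bond a b = true → bond b c = true → bond a c = true →
      ({a, b, c} : Finset (Fin 12)) ∈ tri)
    (link : ∀ v, ∀ A ⊆ tri.filter (fun S => v ∈ S), A.Nonempty →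
      (∀ S ∈ A, ∀ S' ∈ tri, v ∈ S' → (S ∩ S').card = 2 → S' ∈ A) → A = tri.filter fun S => v ∈ S)
    (ang_nonneg : ∀ S v, 0 ≤ ang S v) (ang_zero : ∀ S v, v ∉ S → ang S v = 0)
    (sum_ang : ∀ v, ∑ S ∈ tri, ang S v = 2 * Real.pi)
    (tCorner : ∀ S ∈ tri, (∀ v ∈ S, ∀ w ∈ S, v ≠ w → bond v w = true) → ∀ v ∈ S, ang S v ≤ Real.arccos (1 / 4))
    (tCornerMin : ∀ S ∈ tri, (∀ v ∈ S, ∀ w ∈ S, v ≠ w → bond v w = true) →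
      ∀ v ∈ S, Real.arccos (81 / 200) ≤ ang S v)
    (hCorner : ∀ v a x, ({v, a, x} : Finset (Fin 12)) ∈ tri → bond v a = true → bond a x = true →
      bond v x = false → v ≠ x → ang {v, a, x} v ≤ Real.arccos (807 / 2000))
    (qCorner : ∀ v d a x, ({v, d, a} : Finset (Fin 12)) ∈ tri → bond v d = true → bond v a = true →
      bond d a = false → d ≠ a → bond d x = true → bond x a = true → bond v x = false → x ≠ v →
      ang {v, d, a} v ≤ 2 * Real.arccos (807 / 2000))
    (qCornerMin : ∀ v d a, ({v, d, a} : Finset (Fin 12)) ∈ tri → bond v d = true → bond v a = true →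
      bond d a = false → d ≠ a → Real.arccos (1 / 25) ≤ ang {v, d, a} v)
    (hPairMin : ∀ v a x z, ({v, a, x} : Finset (Fin 12)) ∈ tri → ({v, x, z} : Finset (Fin 12)) ∈ tri →
      bond v a = true → bond v z = true → bond a z = false → a ≠ z →
      Real.arccos (1 / 25) ≤ ang {v, a, x} v + ang {v, x, z} v)
    (two_bond_sides : ∀ S ∈ tri, ∃ a ∈ S, ∀ b ∈ S, b ≠ a → bond a b = true)
    (noOpenStar : ∀ v a₁ a₂ a₃ a₄ a₅ x : Fin 12, Function.Injective ![v, a₁, a₂, a₃, a₄, a₅, x] →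
      bond v a₁ = true → bond v a₂ = true → bond v a₃ = true → bond v a₄ = true → bond v a₅ = true →
      bond a₁ a₂ = true → bond a₂ a₃ = true → bond a₃ a₄ = true → bond a₄ a₅ = true → bond a₅ a₁ = false →
      bond x a₅ = true → bond x a₁ = true → bond v x = false → False) :
    (∀ v, (Finset.univ.filter fun w => bond v w = true).card = 5 →
      ∀ S ∈ tri, v ∈ S → ∀ a ∈ S, ∀ b ∈ S, a ≠ b → bond a b = true) ∧
    (∀ v, (Finset.univ.filter fun w => bond v w = true).card = 4 →
      ((tri.filter fun S => v ∈ S).filter fun S => ∀ a ∈ S, ∀ b ∈ S, a ≠ b → bond a b = true).card ≤ 2) := by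
  have _h₁ := card_tri
  have _h₂ := ang_nonneg
  have key := fun v => ffrK_main bond tri ang bond_symm bond_irrefl bond_deg tri_card two_per_side
    bond_side bond_tri link ang_zero sum_ang tCorner tCornerMin hCorner qCorner qCornerMin hPairMin
    two_bond_sides noOpenStar v
  exact ⟨fun v => (key v).1, fun v => (key v).2⟩

end Summit.AtomisticToContinuum.Crystallization.Theorems

end
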